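import Summits.SmoothPoincare4.SmoothPoincare4.Theses.EntropyRung
import Summits.SmoothPoincare4.SmoothPoincare4.Theorems.EntropyRungSubcylindricalExistenceWeightComparisonIntegral
import HarnessLib

/-!
# The annulus piece floor (helper L3a, stub `helper_annulusPieceFloorI`)

Helper for the crux `SubcylindricalExistence` (ENT), route `EntropyRung`, line
`fat-conical-core-avr-logsobolev`. Weighted conventions (c2) on the background metric `g`:
`c_σ = (4πσ)⁻²`, weight `Φ > 0`, potential `r ≥ 0`,
`F_{Φ,r}(v,σ) = ∫ (σ (r v² + 4 Φ⁻² |∇v|²_g) − v² log v² − 4 v²) c_σ Φ⁴ dV_g`, normalised test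
functions `∫ c_σ v² Φ⁴ dV_g = 1`.

**`helper_annulusPieceFloorI`:** on a region `U` where `Φ` is `e^{±κ}`-close to a model weight
`ψ₀` whose `R`-free clause holds at level `L₀` at all scales (test functions supported in `U`),
with gradient discrepancy `|∇ log(Φ/ψ₀)|²_g ≤ κ₁² ϖ²` on `U`, `∫_U ϖ⁴ ≤ V_U` with `ϖ⁴`
integrable on `U`, and the weighted Sobolev inequality `Y √(∫ u⁴ Φ⁴) ≤ ∫ (6 Φ² |∇u|² + r Φ⁴ u²)`,
the `Φ`-clause with potential `r` holds on `U` at every scale at level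
`L₀ + 2 log(1−κ₀) − 8κ − 2 log(1 + 24 κ₁² √V_U /(κ₀ Y))`, for every `κ₀ ∈ (0,1)`.

This is the registered stub `helper_annulusPieceFloor` with the integrability hypothesis
`IntegrableOn (ϖ⁴) U` added: the registered text only bounds the Bochner integral `∫_U ϖ⁴`,
which is the junk value `0` for non-integrable `ϖ⁴`, and then the discrepancy is not controlled.

Proof. (1) `helper_weightComparison` (with `r₀ = 0`, `ψ₁ = Φ`) leaves the discrepancy
`(16τ/κ₀) E`, `E = ∫ c_τ w² Φ² |∇log(Φ/ψ₀)|²`; (2) Cauchy–Schwarz on `U` and the Sobolev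
inequality absorb it: `(16τ/κ₀) E ≤ β₁ D(w,τ)`, `β₁ = 24 κ₁² √V_U/(κ₀ Y)`,
`D(w,τ) = ∫ τ (r w² + 4Φ⁻²|∇w|²) c_τ Φ⁴` (`discrepancy_absorb`); (3) the scale shift
`(v,σ) ↦ (v/θ, σ/θ)`, `θ = 1 + β₁`, turns the extra `β₁ D` into the level loss `2 log θ`
(`scaleShift_pointwise`). Folklore (Perelman 2002 §3 / Topping 2006 (8.1.8) for the `w`-form).
-/

noncomputable section

open scoped Manifold ContDiff Topology ENNReal NNReal
open Set Filter MeasureTheory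
open Literature.Geometry.Lorentzian Literature.Geometry.Riemannian

set_option linter.dupNamespace false

namespace Summit.SmoothPoincare4.SmoothPoincare4.Theorems

namespace AnnulusPieceFloor

/-- Cauchy–Schwarz for non-negative functions: `∫ f h ≤ √(∫ f²) √(∫ h²)` (Hölder, `p = q = 2`). -/
theorem integral_mul_le_sqrt_mul_sqrt {α : Type*} [MeasurableSpace α] {ν : Measure α} {f h : α → ℝ}
    (hf0 : ∀ x, 0 ≤ f x) (hh0 : ∀ x, 0 ≤ h x) (hf : MemLp f 2 ν) (hh : MemLp h 2 ν) :
    ∫ x, f x * h x ∂ν ≤ Real.sqrt (∫ x, f x ^ 2 ∂ν) * Real.sqrt (∫ x, h x ^ 2 ∂ν) := by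
  have h2 : ENNReal.ofReal (2 : ℝ) = 2 := by norm_num
  have key := integral_mul_le_Lp_mul_Lq_of_nonneg Real.HolderConjugate.two_two (ae_of_all _ hf0)
    (ae_of_all _ hh0) (h2 ▸ hf) (h2 ▸ hh)
  simp only [Real.rpow_two] at key
  rw [Real.sqrt_eq_rpow, Real.sqrt_eq_rpow]
  exact key

/-- The pointwise identity behind the scale shift `(v, σ) ↦ (v/θ, σ/θ)` (`c_{σ/θ} = θ² c_σ`,
`|∇(v/θ)|² = |∇v|²/θ²`): the `F`-density of `(v/θ, σ/θ)` plus `(θ − 1)` times its quadratic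
density equals the `F`-density of `(v, σ)` plus `log θ² · (c_σ v² Φ⁴)`. -/
theorem scaleShift_pointwise {θ σ τ c cτ r P G Gt W : ℝ} (hθ : 0 < θ) (hP : P ≠ 0)
    (hτ : τ = θ⁻¹ * σ) (hcτ : cτ = c * θ ^ 2) (hGt : Gt = θ⁻¹ ^ 2 * G) :
    (τ * (r * (θ⁻¹ * W) ^ 2 + 4 * (P⁻¹ ^ 2 * Gt)) - (θ⁻¹ * W) ^ 2 * Real.log ((θ⁻¹ * W) ^ 2)
        - 4 * (θ⁻¹ * W) ^ 2) * (cτ * P ^ 4)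
      + (θ - 1) * (τ * (r * (θ⁻¹ * W) ^ 2 + 4 * (P⁻¹ ^ 2 * Gt)) * (cτ * P ^ 4)) =
    (σ * (r * W ^ 2 + 4 * (P⁻¹ ^ 2 * G)) - W ^ 2 * Real.log (W ^ 2) - 4 * W ^ 2) * (c * P ^ 4)
      + Real.log (θ ^ 2) * (c * W ^ 2 * P ^ 4) := by
  subst hτ hcτ hGt
  rw [EntropyLocalisation.sq_mul_log_sq_mul θ⁻¹ W]
  have hlog : Real.log (θ⁻¹ ^ 2) = - Real.log (θ ^ 2) := by rw [inv_pow, Real.log_inv]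
  rw [hlog]
  field_simp
  ring

variable {M : Type} [TopologicalSpace M] [ChartedSpace (EuclideanSpace ℝ (Fin 4)) M] [IsManifold (𝓡 4) ∞ M]
  (g : PseudoRiemannianMetric (𝓡 4) ∞ (EuclideanSpace ℝ (Fin 4)) (TangentSpace (𝓡 4) : M → Type _))

/-- The quadratic (Dirichlet–potential) density `τ (r w² + 4 Φ⁻²|∇w|²) (c Φ⁴)` is continuous. -/
theorem continuous_dirichletDensity {Φ r w : M → ℝ} (hΦ : ContMDiff (𝓡 4) 𝓘(ℝ, ℝ) ∞ Φ) (hΦpos : ∀ x, 0 < Φ x)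
    (hr : Continuous r) (hw : ContMDiff (𝓡 4) 𝓘(ℝ, ℝ) ∞ w) (t k : ℝ) :
    Continuous fun x ↦ t * (r x * (w x) ^ 2 + 4 * ((Φ x)⁻¹ ^ 2 * g.gradSq w x)) * (k * (Φ x) ^ 4) := by
  have hwc : Continuous w := hw.continuous
  have hΦc : Continuous Φ := hΦ.continuous
  have hG : Continuous (g.gradSq w) := (contMDiff_gradSq g hw).continuous
  have hinv : Continuous fun x ↦ (Φ x)⁻¹ := hΦc.inv₀ fun x ↦ (hΦpos x).ne'
  exact (continuous_const.mul ((hr.mul (hwc.pow 2)).add (continuous_const.mul ((hinv.pow 2).mul hG)))).mul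
    (continuous_const.mul (hΦc.pow 4))

variable [CompactSpace M] [T3Space M] [MeasurableSpace M] [BorelSpace M]

/-- **Absorption of the gradient discrepancy** (step 2): with `|∇ℓ|²_g ≤ κ₁² ϖ²` on `U`,
`∫_U ϖ⁴ ≤ V_U` (`ϖ⁴` integrable on `U`) and the weighted Sobolev inequality, for `w` supported
in `U`: `(16τ/κ₀) ∫ c w² Φ² |∇ℓ|² ≤ β₁ · ∫ τ (r w² + 4Φ⁻²|∇w|²) c Φ⁴`, `β₁ = 24 κ₁² √V_U/(κ₀ Y)`
(Cauchy–Schwarz on `U`, then Sobolev, then `6 = (3/2)·4` and `r ≥ 0`). -/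
theorem discrepancy_absorb [g.HasLeviCivita] (hg : g.IsRiemannian) {U : Set M} {Φ r ϖ ℓ w : M → ℝ}
    {κ₀ κ₁ V_U Y τ c : ℝ}
    (hΦ : ContMDiff (𝓡 4) 𝓘(ℝ, ℝ) ∞ Φ) (hΦpos : ∀ x, 0 < Φ x) (hr : Continuous r) (hr0 : ∀ x, 0 ≤ r x)
    (hϖm : Measurable ϖ) (hU : MeasurableSet U) (hκ₀ : 0 < κ₀) (hY : 0 < Y) (hτ : 0 < τ) (hc : 0 ≤ c)
    (hgrad : ∀ x ∈ U, g.gradSq ℓ x ≤ κ₁ ^ 2 * ϖ x ^ 2)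
    (hint : IntegrableOn (fun x ↦ ϖ x ^ 4) U (riemannianMeasure (g.toContMDiffRiemannianMetric hg)))
    (hVU : ∫ x in U, ϖ x ^ 4 ∂(riemannianMeasure (g.toContMDiffRiemannianMetric hg)) ≤ V_U)
    (hsob : ∀ u : M → ℝ, ContMDiff (𝓡 4) 𝓘(ℝ, ℝ) ∞ u →
      Y * Real.sqrt (∫ x, u x ^ 4 * Φ x ^ 4 ∂(riemannianMeasure (g.toContMDiffRiemannianMetric hg))) ≤
        ∫ x, (6 * (Φ x ^ 2 * g.gradSq u x) + r x * Φ x ^ 4 * u x ^ 2)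
          ∂(riemannianMeasure (g.toContMDiffRiemannianMetric hg)))
    (hw : ContMDiff (𝓡 4) 𝓘(ℝ, ℝ) ∞ w) (hsupp : tsupport w ⊆ U) :
    16 * τ / κ₀ * ∫ x, c * (w x) ^ 2 * (Φ x) ^ 2 * g.gradSq ℓ x
        ∂(riemannianMeasure (g.toContMDiffRiemannianMetric hg)) ≤
      (24 * κ₁ ^ 2 * Real.sqrt V_U / (κ₀ * Y)) *
        ∫ x, τ * (r x * (w x) ^ 2 + 4 * ((Φ x)⁻¹ ^ 2 * g.gradSq w x)) * (c * (Φ x) ^ 4)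
          ∂(riemannianMeasure (g.toContMDiffRiemannianMetric hg)) := by
  set μ : Measure M := riemannianMeasure (g.toContMDiffRiemannianMetric hg) with hμ
  haveI hμfin : IsFiniteMeasure μ := isFiniteMeasure_riemannianMeasure _
  have hintc : ∀ {F : M → ℝ}, Continuous F → Integrable F μ := fun hF ↦
    EntropyLocalisation.integrable_of_continuous_finite hF μ
  have hwc : Continuous w := hw.continuous
  have hΦc : Continuous Φ := hΦ.continuous
  have hGw : Continuous (g.gradSq w) := (contMDiff_gradSq g hw).continuous
  -- the two Cauchy–Schwarz factors
  set f : M → ℝ := fun x ↦ (w x) ^ 2 * (Φ x) ^ 2 with hf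
  set h : M → ℝ := fun x ↦ ϖ x ^ 2 with hh
  have hfc : Continuous f := (hwc.pow 2).mul (hΦc.pow 2)
  have hf0 : ∀ x, 0 ≤ f x := fun x ↦ by positivity
  have hh0 : ∀ x, 0 ≤ h x := fun x ↦ by positivity
  have hhm : AEStronglyMeasurable h (μ.restrict U) := (hϖm.pow_const 2).aestronglyMeasurable
  obtain ⟨C, hC⟩ := (isCompact_range hfc).isBounded.exists_norm_le
  have hfC : ∀ x, ‖f x‖ ≤ C := fun x ↦ hC _ ⟨x, rfl⟩
  have hfmem : MemLp f 2 (μ.restrict U) := MemLp.of_bound hfc.aestronglyMeasurable C (ae_of_all _ hfC)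
  have hh4 : (fun x ↦ h x ^ 2) = fun x ↦ ϖ x ^ 4 := funext fun x ↦ by simp only [hh]; ring
  have hhmem : MemLp h 2 (μ.restrict U) := by
    rw [memLp_two_iff_integrable_sq hhm, hh4]; exact hint
  have hhint : Integrable h (μ.restrict U) := hhmem.integrable one_le_two
  have hfhU : IntegrableOn (fun x ↦ f x * h x) U μ := hhint.bdd_mul hfc.aestronglyMeasurable (ae_of_all _ hfC)
  -- `w` vanishes off `U`
  have hw0 : ∀ x ∉ U, w x = 0 := fun x hx ↦ image_eq_zero_of_notMem_tsupport fun h' ↦ hx (hsupp h')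
  -- (i) pointwise bound by the indicator of `U`
  have hpt : ∀ x, c * (w x) ^ 2 * (Φ x) ^ 2 * g.gradSq ℓ x ≤ c * κ₁ ^ 2 * U.indicator (fun x ↦ f x * h x) x := by
    intro x
    by_cases hx : x ∈ U
    · rw [indicator_of_mem hx]
      calc c * (w x) ^ 2 * (Φ x) ^ 2 * g.gradSq ℓ x ≤ c * (w x) ^ 2 * (Φ x) ^ 2 * (κ₁ ^ 2 * ϖ x ^ 2) :=
            mul_le_mul_of_nonneg_left (hgrad x hx) (by positivity)
        _ = c * κ₁ ^ 2 * (f x * h x) := by simp only [hf, hh]; ring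
    · rw [indicator_of_notMem hx, hw0 x hx]; simp
  have hE0 : ∀ x, 0 ≤ c * (w x) ^ 2 * (Φ x) ^ 2 * g.gradSq ℓ x := fun x ↦
    mul_nonneg (by positivity) (g.gradSq_nonneg hg ℓ x)
  have hIind : Integrable (fun x ↦ c * κ₁ ^ 2 * U.indicator (fun x ↦ f x * h x) x) μ :=
    (hfhU.integrable_indicator hU).const_mul _
  have h1 : ∫ x, c * (w x) ^ 2 * (Φ x) ^ 2 * g.gradSq ℓ x ∂μ ≤ c * κ₁ ^ 2 * ∫ x in U, f x * h x ∂μ := by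
    have := integral_mono_of_nonneg (ae_of_all _ hE0) hIind (ae_of_all _ hpt)
    rwa [integral_const_mul, integral_indicator hU] at this
  -- (ii) Cauchy–Schwarz on `U`
  have h2 : ∫ x in U, f x * h x ∂μ ≤ Real.sqrt (∫ x in U, f x ^ 2 ∂μ) * Real.sqrt (∫ x in U, h x ^ 2 ∂μ) :=
    integral_mul_le_sqrt_mul_sqrt hf0 hh0 hfmem hhmem
  -- (iii) the two factors
  have hf4 : (fun x ↦ f x ^ 2) = fun x ↦ w x ^ 4 * Φ x ^ 4 := funext fun x ↦ by simp only [hf]; ring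
  have h3 : Real.sqrt (∫ x in U, f x ^ 2 ∂μ) ≤ Real.sqrt (∫ x, w x ^ 4 * Φ x ^ 4 ∂μ) := by
    apply Real.sqrt_le_sqrt
    rw [hf4]
    exact setIntegral_le_integral (hintc ((hwc.pow 4).mul (hΦc.pow 4))) (ae_of_all _ fun x ↦ by positivity)
  have h4 : Real.sqrt (∫ x in U, h x ^ 2 ∂μ) ≤ Real.sqrt V_U := by
    apply Real.sqrt_le_sqrt
    rw [hh4]
    exact hVU
  -- (iv) Sobolev and (v) comparison with the quadratic form
  set Q : ℝ := ∫ x, (r x * Φ x ^ 4 * w x ^ 2 + 4 * (Φ x ^ 2 * g.gradSq w x)) ∂μ with hQ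
  have hS := hsob w hw
  have hIS : Integrable (fun x ↦ 6 * (Φ x ^ 2 * g.gradSq w x) + r x * Φ x ^ 4 * w x ^ 2) μ :=
    hintc ((continuous_const.mul ((hΦc.pow 2).mul hGw)).add ((hr.mul (hΦc.pow 4)).mul (hwc.pow 2)))
  have hIQ : Integrable (fun x ↦ r x * Φ x ^ 4 * w x ^ 2 + 4 * (Φ x ^ 2 * g.gradSq w x)) μ :=
    hintc (((hr.mul (hΦc.pow 4)).mul (hwc.pow 2)).add (continuous_const.mul ((hΦc.pow 2).mul hGw)))
  have h5 : ∫ x, (6 * (Φ x ^ 2 * g.gradSq w x) + r x * Φ x ^ 4 * w x ^ 2) ∂μ ≤ 3 / 2 * Q := by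
    rw [hQ, ← integral_const_mul]
    refine integral_mono hIS (hIQ.const_mul _) fun x ↦ ?_
    have : 0 ≤ r x * Φ x ^ 4 * w x ^ 2 := by have := hr0 x; positivity
    dsimp only
    linarith
  have hQ0 : 0 ≤ Q := integral_nonneg fun x ↦ by
    have := hr0 x; have := g.gradSq_nonneg hg w x; positivity
  have hD : ∫ x, τ * (r x * (w x) ^ 2 + 4 * ((Φ x)⁻¹ ^ 2 * g.gradSq w x)) * (c * (Φ x) ^ 4) ∂μ = τ * c * Q := by
    rw [hQ, ← integral_const_mul]
    refine integral_congr_ae (ae_of_all _ fun x ↦ ?_)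
    have hΦx : Φ x ≠ 0 := (hΦpos x).ne'
    field_simp
  -- assemble
  have hsq : Real.sqrt (∫ x, w x ^ 4 * Φ x ^ 4 ∂μ) ≤ 3 / 2 * Q / Y := by
    rw [le_div_iff₀ hY, mul_comm]
    exact hS.trans h5
  have hE : ∫ x, c * (w x) ^ 2 * (Φ x) ^ 2 * g.gradSq ℓ x ∂μ ≤ c * κ₁ ^ 2 * ((3 / 2 * Q / Y) * Real.sqrt V_U) := by
    refine h1.trans (mul_le_mul_of_nonneg_left (h2.trans ?_) (by positivity))
    exact mul_le_mul (h3.trans hsq) h4 (Real.sqrt_nonneg _) (by positivity)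
  rw [hD]
  have hfin : 16 * τ / κ₀ * (c * κ₁ ^ 2 * ((3 / 2 * Q / Y) * Real.sqrt V_U)) =
      (24 * κ₁ ^ 2 * Real.sqrt V_U / (κ₀ * Y)) * (τ * c * Q) := by
    field_simp
    ring
  calc 16 * τ / κ₀ * ∫ x, c * (w x) ^ 2 * (Φ x) ^ 2 * g.gradSq ℓ x ∂μ
      ≤ 16 * τ / κ₀ * (c * κ₁ ^ 2 * ((3 / 2 * Q / Y) * Real.sqrt V_U)) :=
        mul_le_mul_of_nonneg_left hE (by positivity)
    _ = (24 * κ₁ ^ 2 * Real.sqrt V_U / (κ₀ * Y)) * (τ * c * Q) := hfin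

end AnnulusPieceFloor

open WeightComparison AnnulusPieceFloor in
/-- **Helper L3a (registered stub `helper_annulusPieceFloorI`) — the annulus piece floor.**
On a region `U` where the weight `Φ` is `e^{±κ}`-close to a model weight `ψ₀` whose `R`-free
clause holds at level `L₀` (all scales), with gradient discrepancy `|∇log(Φ/ψ₀)|²_g ≤ κ₁² ϖ²`,
`∫_U ϖ⁴ ≤ V_U` (`ϖ⁴` integrable on `U`), and the weighted Sobolev inequality (constant `Y`),
the weighted clause for `Φ` (potential `r ≥ 0`) holds on `U` at every scale at level
`L₀ + 2 log(1−κ₀) − 8κ − 2 log(1 + 24 κ₁² √V_U /(κ₀ Y))`. See the module docstring. -/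
theorem helper_annulusPieceFloorI :
    ∀ (M : Type) [TopologicalSpace M] [T2Space M] [SecondCountableTopology M]
      [ChartedSpace (EuclideanSpace ℝ (Fin 4)) M] [IsManifold (𝓡 4) ∞ M] [CompactSpace M]
      [T3Space M] [MeasurableSpace M] [BorelSpace M]
      (g : PseudoRiemannianMetric (𝓡 4) ∞ (EuclideanSpace ℝ (Fin 4)) (TangentSpace (𝓡 4) : M → Type _))
      [g.HasLeviCivita] (hg : g.IsRiemannian) (U : Set M) (Φ ψ₀ r ϖ : M → ℝ) (L₀ κ κ₀ κ₁ V_U Y : ℝ),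
      ContMDiff (𝓡 4) 𝓘(ℝ, ℝ) ∞ Φ → ContMDiff (𝓡 4) 𝓘(ℝ, ℝ) ∞ ψ₀ → (∀ x, 0 < Φ x) → (∀ x, 0 < ψ₀ x) →
      Continuous r → (∀ x, 0 ≤ r x) → Measurable ϖ → (∀ x, 0 ≤ ϖ x) → MeasurableSet U →
      0 ≤ κ → 0 < κ₀ → κ₀ < 1 → 0 ≤ κ₁ → 0 ≤ V_U → 0 < Y →
      (∀ x ∈ U, Real.exp (-κ) ≤ Φ x / ψ₀ x ∧ Φ x / ψ₀ x ≤ Real.exp κ) →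
      (∀ x ∈ U, g.gradSq (fun y ↦ Real.log (Φ y / ψ₀ y)) x ≤ κ₁ ^ 2 * ϖ x ^ 2) →
      (∫ x in U, ϖ x ^ 4 ∂(riemannianMeasure (g.toContMDiffRiemannianMetric hg)) ≤ V_U) →
      IntegrableOn (fun x ↦ ϖ x ^ 4) U (riemannianMeasure (g.toContMDiffRiemannianMetric hg)) →
      (∀ u : M → ℝ, ContMDiff (𝓡 4) 𝓘(ℝ, ℝ) ∞ u →
        Y * Real.sqrt (∫ x, u x ^ 4 * Φ x ^ 4 ∂(riemannianMeasure (g.toContMDiffRiemannianMetric hg))) ≤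
          ∫ x, (6 * (Φ x ^ 2 * g.gradSq u x) + r x * Φ x ^ 4 * u x ^ 2)
            ∂(riemannianMeasure (g.toContMDiffRiemannianMetric hg))) →
      (∀ s : ℝ, 0 < s → ∀ v : M → ℝ, ContMDiff (𝓡 4) 𝓘(ℝ, ℝ) ∞ v → tsupport v ⊆ U →
        ∫ x, (4 * Real.pi * s) ^ (-(4 : ℝ) / 2) * (v x) ^ 2 * (ψ₀ x) ^ 4
            ∂(riemannianMeasure (g.toContMDiffRiemannianMetric hg)) = 1 →
          L₀ ≤ ∫ x, (s * (4 * ((ψ₀ x)⁻¹ ^ 2 * g.gradSq v x))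
              - (v x) ^ 2 * Real.log ((v x) ^ 2) - 4 * (v x) ^ 2)
              * ((4 * Real.pi * s) ^ (-(4 : ℝ) / 2) * (ψ₀ x) ^ 4)
            ∂(riemannianMeasure (g.toContMDiffRiemannianMetric hg))) →
      ∀ σ : ℝ, 0 < σ → ∀ v : M → ℝ, ContMDiff (𝓡 4) 𝓘(ℝ, ℝ) ∞ v → tsupport v ⊆ U →
        ∫ x, (4 * Real.pi * σ) ^ (-(4 : ℝ) / 2) * (v x) ^ 2 * (Φ x) ^ 4
            ∂(riemannianMeasure (g.toContMDiffRiemannianMetric hg)) = 1 →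
          L₀ + 2 * Real.log (1 - κ₀) - 8 * κ - 2 * Real.log (1 + 24 * κ₁ ^ 2 * Real.sqrt V_U / (κ₀ * Y)) ≤
            ∫ x, (σ * (r x * (v x) ^ 2 + 4 * ((Φ x)⁻¹ ^ 2 * g.gradSq v x))
                - (v x) ^ 2 * Real.log ((v x) ^ 2) - 4 * (v x) ^ 2)
                * ((4 * Real.pi * σ) ^ (-(4 : ℝ) / 2) * (Φ x) ^ 4)
              ∂(riemannianMeasure (g.toContMDiffRiemannianMetric hg)) := by
  intro M _ _ _ _ _ _ _ _ _ g _ hg U Φ ψ₀ r ϖ L₀ κ κ₀ κ₁ V_U Y hΦ hψ₀ hΦpos hψ₀pos hrc hr0 hϖm _hϖ0 hU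
    hκ hκ₀ hκ₀1 _hκ₁ _hV hY hρ hgrad hVU hint hsob hmodel σ hσ v hv hsupp hnorm
  set μ : Measure M := riemannianMeasure (g.toContMDiffRiemannianMetric hg) with hμ
  haveI hμfin : IsFiniteMeasure μ := isFiniteMeasure_riemannianMeasure _
  have hintc : ∀ {F : M → ℝ}, Continuous F → Integrable F μ := fun hF ↦
    EntropyLocalisation.integrable_of_continuous_finite hF μ
  set cσ : ℝ := (4 * Real.pi * σ) ^ (-(4 : ℝ) / 2) with hcσ
  set β₁ : ℝ := 24 * κ₁ ^ 2 * Real.sqrt V_U / (κ₀ * Y) with hβ₁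
  set θ : ℝ := 1 + β₁ with hθ
  have hβ0 : 0 ≤ β₁ := by positivity
  have hθpos : 0 < θ := by linarith
  have hθinv : 0 < θ⁻¹ := inv_pos.2 hθpos
  -- the shifted scale and test function
  set τ : ℝ := θ⁻¹ * σ with hτ
  have hτpos : 0 < τ := mul_pos hθinv hσ
  set vt : M → ℝ := fun x ↦ θ⁻¹ * v x with hvt
  have hvts : ContMDiff (𝓡 4) 𝓘(ℝ, ℝ) ∞ vt := contMDiff_const.mul hv
  have hsuppt : tsupport vt ⊆ U := (tsupport_mul_subset_right (f := fun _ ↦ θ⁻¹) (g := v)).trans hsupp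
  have hcτ : (4 * Real.pi * τ) ^ (-(4 : ℝ) / 2) = cσ * θ ^ 2 := by
    rw [hτ, normConst_rescale hθinv hσ, ← hcσ, inv_pow, div_inv_eq_mul]
  have hnormt : ∫ x, (4 * Real.pi * τ) ^ (-(4 : ℝ) / 2) * (vt x) ^ 2 * (Φ x) ^ 4 ∂μ = 1 := by
    have h1 : ∀ x, (4 * Real.pi * τ) ^ (-(4 : ℝ) / 2) * (vt x) ^ 2 * (Φ x) ^ 4 = cσ * (v x) ^ 2 * (Φ x) ^ 4 := by
      intro x; rw [hcτ]; simp only [hvt]; field_simp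
    simp_rw [h1]; exact hnorm
  -- (1) weight comparison with `r₀ = 0`, `ψ₁ = Φ`, `r₁ = r`
  have hmodel' : ∀ s : ℝ, 0 < s → ∀ w : M → ℝ, ContMDiff (𝓡 4) 𝓘(ℝ, ℝ) ∞ w → tsupport w ⊆ U →
      ∫ x, (4 * Real.pi * s) ^ (-(4 : ℝ) / 2) * (w x) ^ 2 * (ψ₀ x) ^ 4 ∂μ = 1 →
      L₀ ≤ ∫ x, (s * ((fun _ : M ↦ (0 : ℝ)) x * (w x) ^ 2 + 4 * ((ψ₀ x)⁻¹ ^ 2 * g.gradSq w x))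
          - (w x) ^ 2 * Real.log ((w x) ^ 2) - 4 * (w x) ^ 2)
          * ((4 * Real.pi * s) ^ (-(4 : ℝ) / 2) * (ψ₀ x) ^ 4) ∂μ := by
    intro s hs w hw hsw hn
    simpa only [zero_mul, zero_add] using hmodel s hs w hw hsw hn
  have H1 := helper_weightComparison M g hg U ψ₀ Φ (fun _ ↦ (0 : ℝ)) r L₀ κ κ₀ hψ₀ hΦ hψ₀pos hΦpos
    continuous_const hrc hκ hκ₀ hκ₀1 hρ (fun _ _ ↦ le_rfl) (fun x _ ↦ by simpa using hr0 x) hmodel'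
    τ hτpos vt hvts hsuppt hnormt
  -- (2) absorption of the discrepancy
  have H2 := discrepancy_absorb g hg (ℓ := fun y ↦ Real.log (Φ y / ψ₀ y)) hΦ hΦpos hrc hr0 hϖm hU hκ₀ hY
    hτpos (Real.rpow_pos_of_pos (by positivity : (0 : ℝ) < 4 * Real.pi * τ) (-(4 : ℝ) / 2)).le
    hgrad hint hVU hsob hvts hsuppt
  -- (3) the scale shift
  have hpt : ∀ x, (τ * (r x * (vt x) ^ 2 + 4 * ((Φ x)⁻¹ ^ 2 * g.gradSq vt x))
        - (vt x) ^ 2 * Real.log ((vt x) ^ 2) - 4 * (vt x) ^ 2) * ((4 * Real.pi * τ) ^ (-(4 : ℝ) / 2) * (Φ x) ^ 4)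
      + (θ - 1) * (τ * (r x * (vt x) ^ 2 + 4 * ((Φ x)⁻¹ ^ 2 * g.gradSq vt x))
        * ((4 * Real.pi * τ) ^ (-(4 : ℝ) / 2) * (Φ x) ^ 4)) =
      (σ * (r x * (v x) ^ 2 + 4 * ((Φ x)⁻¹ ^ 2 * g.gradSq v x)) - (v x) ^ 2 * Real.log ((v x) ^ 2)
        - 4 * (v x) ^ 2) * (cσ * (Φ x) ^ 4) + Real.log (θ ^ 2) * (cσ * (v x) ^ 2 * (Φ x) ^ 4) := fun x ↦
    scaleShift_pointwise hθpos (hΦpos x).ne' hτ hcτ (g.gradSq_const_mul v θ⁻¹ x)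
  have hIFt : Integrable (fun x ↦ (τ * (r x * (vt x) ^ 2 + 4 * ((Φ x)⁻¹ ^ 2 * g.gradSq vt x))
      - (vt x) ^ 2 * Real.log ((vt x) ^ 2) - 4 * (vt x) ^ 2) * ((4 * Real.pi * τ) ^ (-(4 : ℝ) / 2) * (Φ x) ^ 4)) μ :=
    hintc (LargeScale.continuous_density g hΦ hΦpos hrc hvts τ _)
  have hIDt : Integrable (fun x ↦ τ * (r x * (vt x) ^ 2 + 4 * ((Φ x)⁻¹ ^ 2 * g.gradSq vt x))
      * ((4 * Real.pi * τ) ^ (-(4 : ℝ) / 2) * (Φ x) ^ 4)) μ :=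
    hintc (continuous_dirichletDensity g hΦ hΦpos hrc hvts τ _)
  have hIF : Integrable (fun x ↦ (σ * (r x * (v x) ^ 2 + 4 * ((Φ x)⁻¹ ^ 2 * g.gradSq v x))
      - (v x) ^ 2 * Real.log ((v x) ^ 2) - 4 * (v x) ^ 2) * (cσ * (Φ x) ^ 4)) μ :=
    hintc (LargeScale.continuous_density g hΦ hΦpos hrc hv σ cσ)
  have hIm : Integrable (fun x ↦ cσ * (v x) ^ 2 * (Φ x) ^ 4) μ :=
    hintc ((continuous_const.mul (hv.continuous.pow 2)).mul (hΦ.continuous.pow 4))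
  have H3 : (∫ x, (τ * (r x * (vt x) ^ 2 + 4 * ((Φ x)⁻¹ ^ 2 * g.gradSq vt x))
        - (vt x) ^ 2 * Real.log ((vt x) ^ 2) - 4 * (vt x) ^ 2) * ((4 * Real.pi * τ) ^ (-(4 : ℝ) / 2) * (Φ x) ^ 4) ∂μ)
      + (θ - 1) * ∫ x, τ * (r x * (vt x) ^ 2 + 4 * ((Φ x)⁻¹ ^ 2 * g.gradSq vt x))
        * ((4 * Real.pi * τ) ^ (-(4 : ℝ) / 2) * (Φ x) ^ 4) ∂μ =
      (∫ x, (σ * (r x * (v x) ^ 2 + 4 * ((Φ x)⁻¹ ^ 2 * g.gradSq v x)) - (v x) ^ 2 * Real.log ((v x) ^ 2)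
        - 4 * (v x) ^ 2) * (cσ * (Φ x) ^ 4) ∂μ) + Real.log (θ ^ 2) := by
    rw [← integral_const_mul, ← integral_add hIFt (hIDt.const_mul _), integral_congr_ae (ae_of_all _ hpt),
      integral_add hIF (hIm.const_mul _), integral_const_mul, hnorm, mul_one]
  have hθ1 : θ - 1 = β₁ := by rw [hθ]; ring
  have hlog : Real.log (θ ^ 2) = 2 * Real.log θ := by rw [Real.log_pow]; push_cast; ring
  rw [hθ1, hlog] at H3
  linarith [H1, H2, H3]

end Summit.SmoothPoincare4.SmoothPoincare4.Theorems

end
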